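import Mathlib.Analysis.Convex.SpecificFunctions.Basic
import Mathlib.Analysis.Convex.Slope
import Mathlib.Analysis.SpecialFunctions.Pow.Real
import HarnessLib

/-!
# Convexity of `x ↦ x^{−s}` and the three-point (secant) bounds for block interpolation of the weights `n^{−s}`

Topic `Literature/NumberTheory/LFunctions`; namespace `Literature.NumberTheory.LFunctions.LTruncation`. THEOREMS only (no
definition, no named fact, no `sorry`). The analytic input of the PACKED truncation certificates (cell `parity-realchar`,
TARGET §2 row 19, design note `HOME/parity-realchar-prover-2/DESIGN-packed-truncation-engine.md`, theory ruling
2026-08-27T22:11:54Z): inside a block `n₀ ≤ n ≤ n₁` of consecutive terms the weights `n^{−s}` are replaced by AFFINE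
bounds obtained from rigorous enclosures at the block endpoints only — the chord over `[n₀, n₁]` from above and the
secant of the next block `[n₁, n₂]` extended to the left from below — which is legitimate because `x ↦ x^{−s}` is
convex on `(0, ∞)` for `s ≥ 0` (Hardy–Littlewood–Pólya §3.5: `x^k` is convex for `k ∉ (0, 1)`):
* `convexOn_rpow_neg` — convexity (via `x^{−s} = exp(−s log x)`, `log` concave, `exp` convex increasing);
* `rpow_neg_le_chord` — `f(n) ≤ f(n₀) + (f(n₁) − f(n₀))·(n − n₀)/(n₁ − n₀)` on `[n₀, n₁]`;
* `rpow_neg_ge_secant` — `f(n) ≥ f(n₁) + (f(n₁) − f(n₂))·(n₁ − n)/(n₂ − n₁)` for `n ≤ n₁ < n₂`.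

## References

* G. H. Hardy, J. E. Littlewood, G. Pólya, *Inequalities*, 2nd ed., CUP 1952, §3.5–§3.9 (convexity of power functions).
  [HardyLittlewoodPolya1952]
* K. S. Chua, *Real zeros of Dedekind zeta functions of real quadratic fields*, Math. Comp. 74 (2005), §2.2 ALGO 1 (grid
  evaluation of the truncated series). [Chua2005RealZeros]
-/

noncomputable section

open Set

namespace Literature.NumberTheory.LFunctions

namespace LTruncation

/-- **`x ↦ x^{−s}` is convex on `(0, ∞)` for `s ≥ 0`** (HLP: `x^k` is convex for `k ≤ 0`): `x^{−s} = exp(−s·log x)` with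
`log` concave and `exp` convex and increasing. [cite: HardyLittlewoodPolya1952, §3.5] -/
theorem convexOn_rpow_neg {s : ℝ} (hs : 0 ≤ s) : ConvexOn ℝ (Ioi (0 : ℝ)) fun x : ℝ => x ^ (-s) := by
  refine ⟨convex_Ioi 0, fun x hx y hy a b ha hb hab => ?_⟩
  have hx0 : 0 < x := hx
  have hy0 : 0 < y := hy
  have hxy : 0 < a • x + b • y := by
    rcases ha.eq_or_lt with rfl | ha'
    · simp only [zero_smul, zero_add] at hab ⊢; rw [hab, one_smul]; exact hy0
    · exact add_pos_of_pos_of_nonneg (by rw [smul_eq_mul]; exact mul_pos ha' hx0)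
        (by rw [smul_eq_mul]; exact mul_nonneg hb hy0.le)
  simp only [smul_eq_mul] at hxy ⊢
  rw [Real.rpow_def_of_pos hxy, Real.rpow_def_of_pos hx0, Real.rpow_def_of_pos hy0]
  -- log is concave: a log x + b log y ≤ log (a x + b y)
  have hlog := (strictConcaveOn_log_Ioi.concaveOn).2 hx hy ha hb hab
  simp only [smul_eq_mul] at hlog
  -- hence −s log(ax+by) ≤ a(−s log x) + b(−s log y)
  have h1 : Real.log (a * x + b * y) * (-s) ≤ a * (Real.log x * (-s)) + b * (Real.log y * (-s)) := by
    nlinarith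
  -- exp is convex and monotone
  have h2 := (convexOn_exp).2 (mem_univ (Real.log x * (-s))) (mem_univ (Real.log y * (-s))) ha hb hab
  simp only [smul_eq_mul] at h2
  exact (Real.exp_le_exp.2 h1).trans h2

/-- **Chord bound** (upper): for `0 < n₀ < n₁`, `n₀ ≤ n ≤ n₁` and `s ≥ 0`,
`n^{−s} ≤ n₀^{−s} + (n₁^{−s} − n₀^{−s})·(n − n₀)/(n₁ − n₀)`. [cite: HardyLittlewoodPolya1952, §3.5] -/
theorem rpow_neg_le_chord {s : ℝ} (hs : 0 ≤ s) {x₀ x₁ x : ℝ} (h0 : 0 < x₀) (h01 : x₀ < x₁) (hx0 : x₀ ≤ x)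
    (hx1 : x ≤ x₁) :
    x ^ (-s) ≤ x₀ ^ (-s) + (x₁ ^ (-s) - x₀ ^ (-s)) * ((x - x₀) / (x₁ - x₀)) := by
  have hconv := convexOn_rpow_neg hs
  have hd : 0 < x₁ - x₀ := by linarith
  set b := (x - x₀) / (x₁ - x₀) with hb
  set a := 1 - b with ha
  have hb0 : 0 ≤ b := div_nonneg (by linarith) hd.le
  have hb1 : b ≤ 1 := by rw [hb, div_le_one hd]; linarith
  have ha0 : 0 ≤ a := by rw [ha]; linarith
  have hab : a + b = 1 := by rw [ha]; ring
  have hxeq : a • x₀ + b • x₁ = x := by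
    simp only [smul_eq_mul, ha, hb]; field_simp; ring
  have := hconv.2 (show x₀ ∈ Ioi (0:ℝ) from h0) (show x₁ ∈ Ioi (0:ℝ) from h0.trans h01) ha0 hb0 hab
  rw [hxeq] at this
  simp only [smul_eq_mul] at this
  calc x ^ (-s) ≤ a * x₀ ^ (-s) + b * x₁ ^ (-s) := this
    _ = x₀ ^ (-s) + (x₁ ^ (-s) - x₀ ^ (-s)) * b := by rw [ha]; ring

/-- **Secant bound** (lower): for `0 < x ≤ x₁ < x₂` and `s ≥ 0`,
`x^{−s} ≥ x₁^{−s} + (x₁^{−s} − x₂^{−s})·(x₁ − x)/(x₂ − x₁)` (the secant of `[x₁, x₂]` extended to the left lies below a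
convex function). [cite: HardyLittlewoodPolya1952, §3.5] -/
theorem rpow_neg_ge_secant {s : ℝ} (hs : 0 ≤ s) {x x₁ x₂ : ℝ} (hx : 0 < x) (hx1 : x ≤ x₁) (h12 : x₁ < x₂) :
    x₁ ^ (-s) + (x₁ ^ (-s) - x₂ ^ (-s)) * ((x₁ - x) / (x₂ - x₁)) ≤ x ^ (-s) := by
  have hconv := convexOn_rpow_neg hs
  rcases hx1.eq_or_lt with rfl | hlt
  · simp
  have hslope := hconv.slope_mono_adjacent (show x ∈ Ioi (0:ℝ) from hx) (show x₂ ∈ Ioi (0:ℝ) from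
    (hx.trans_le hx1).trans h12) hlt h12
  -- (f x₁ − f x)/(x₁ − x) ≤ (f x₂ − f x₁)/(x₂ − x₁)
  have hd1 : 0 < x₁ - x := by linarith
  have hd2 : 0 < x₂ - x₁ := by linarith
  rw [div_le_div_iff₀ hd1 hd2] at hslope
  have hkey : (x₁ ^ (-s) - x₂ ^ (-s)) * (x₁ - x) ≤ (x ^ (-s) - x₁ ^ (-s)) * (x₂ - x₁) := by nlinarith
  have : (x₁ ^ (-s) - x₂ ^ (-s)) * ((x₁ - x) / (x₂ - x₁)) ≤ x ^ (-s) - x₁ ^ (-s) := by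
    rw [← mul_div_assoc, div_le_iff₀ hd2]; exact hkey
  linarith

/-- **Tangent bound below** (Bernoulli form): for `0 ≤ s ≤ 1` and `m, x > 0`,
`m^{-s} (1 − s (x − m)/m) ≤ x^{-s}` — the tangent of the convex `x ↦ x^{-s}` at `m` lies below the graph.
[cite: HardyLittlewoodPolya1952, §3.5 (Thm 41, Bernoulli's inequality)] -/
theorem rpow_neg_ge_tangent {s : ℝ} (hs0 : 0 ≤ s) (hs1 : s ≤ 1) {m x : ℝ} (hm : 0 < m) (hx : 0 < x) :
    m ^ (-s) * (1 - s * ((x - m) / m)) ≤ x ^ (-s) := by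
  set t : ℝ := (x - m) / m with ht
  have ht1 : -1 < t := by
    rw [ht, lt_div_iff₀ hm]; linarith
  have hxt : x = m * (1 + t) := by rw [ht]; field_simp; ring
  have h1t : 0 < 1 + t := by linarith
  have hms : 0 < m ^ (-s) := Real.rpow_pos_of_pos hm _
  -- `x^{-s} = m^{-s} (1+t)^{-s}`
  have hsplit : x ^ (-s) = m ^ (-s) * (1 + t) ^ (-s) := by
    rw [hxt, Real.mul_rpow hm.le h1t.le]
  rw [hsplit]
  refine mul_le_mul_of_nonneg_left ?_ hms.le
  -- Bernoulli: `(1+t)^s ≤ 1 + s t`, hence `(1+t)^{-s} ≥ 1/(1 + s t) ≥ 1 − s t`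
  have hB : (1 + t) ^ s ≤ 1 + s * t := rpow_one_add_le_one_add_mul_self ht1.le hs0 hs1
  have hpos : 0 < (1 + t) ^ s := Real.rpow_pos_of_pos h1t _
  rw [Real.rpow_neg h1t.le]
  by_cases hst : 1 - s * t ≤ 0
  · exact hst.trans (inv_pos.2 hpos).le
  · have h1st : 0 < 1 + s * t := by
      by_cases ht0 : 0 ≤ t
      · positivity
      · nlinarith
    calc 1 - s * t ≤ (1 + s * t)⁻¹ := by
          rw [inv_eq_one_div, le_div_iff₀ h1st]; nlinarith [sq_nonneg (s * t)]
      _ ≤ ((1 + t) ^ s)⁻¹ := inv_anti₀ hpos hB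

end LTruncation

end Literature.NumberTheory.LFunctions
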